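import Mathlib
import Literature.NumberTheory.LFunctions.Zhang2022.Section4ContourShift
import Literature.NumberTheory.LFunctions.Zhang2022.Section4PerronTailBounds
import Literature.NumberTheory.LFunctions.Zhang2022.SkeletonAssembly
import HarnessLib

/-!
# Zhang (2022) §4, proof of (4.8): `Z̃(s+w,ψ)` and the middle sum on the shifted contour of (4.8)
# (DAG `Z22:§4.u033`–`u034`, locator [Z22 p.20, tex L1104–L1110]) — parameter bookkeeping

Topic `Literature/NumberTheory/LFunctions/Zhang2022` (Landau–Siegel audit tree; verdict-neutral).
Y. Zhang, *Discrete mean estimates and the Landau–Siegel zero*, arXiv:2211.02515v1 (2022)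
[Zhang2022LandauSiegel] — **an unrefereed manuscript under adjudication; nothing here asserts or
denies its Theorems 1–2.** Campaign D-0069 (discharge lane, seat d05), §4 p. 20:

> By a trivial bound for `ω₁(w)` and (4.5) we see that the left side of (4.8) is
> `≪ P^{1−2σ}∫_{−𝓛²⁰}^{𝓛²⁰} |Σ_{D⁴<n≤P²} ν(n)ψ(n)n^{−(s*+iv)}| dv/(α+iv) + ε` with `s* = 1 + α − s̄`.

This THEOREM-ONLY file (first of three: `…Line48TildeZ`, `…Line48Pieces`, `…Line48Bound`) supplies,
for `s` in the WIDE strip `Ω₃′ = {½ − 3α < σ < 1 + α, |t − 2πt₀| < 𝓛₁ + 3}` (`Skeleton.Omega3Wide`,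
GAP row G-L1t7-1; it contains `Ω₃`) and `𝓛 ≥ 4`:

* `norm_tildeZW_ray_le` — **"(4.5)" on the ray `w = −α + iv`, `|v| ≤ 𝓛²⁰`**:
  `|Z̃(s − α + iv, ψ)| ≤ 2e^{2π+2}·P^{1−2σ}`, from (4.5) in its height-uniform form
  (`Section4.norm_tildeZ_le_two_mul`, the tree's Stirling `GammaFactor.abs_norm_tildeZ_sub_le`; the
  heights `t + v` leave the printed window of (4.5) — GAP row G-d04-1, harmless) and the comparison
  `(Dp²(t′/2π)²)^{½−σ+α} ≤ e^{2π+2}P^{1−2σ}` (`log(Dp²(t′/2π)²) = 2𝓛⁹ + O(𝓛)`, `P^{2α} = e^{2π}`);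
* `norm_tildeZW_horiz_le`, `norm_tildeZW_tail_le` — `Z̃` on the horizontal segments
  (`≤ 2e^{2𝓛⁹+1045𝓛}`) and on the tails `Re(s+w) = −½` (`≤ 196Dp²𝓛¹⁰³⁸v²`, no Stirling:
  `Section4.norm_tildeZW_le_of_re`, `|τ(θ)| = √k`);
* `sum_norm_nu_le_bigP_pow_four` (`Σ_{D⁴<n≤P²}|ν(n)| ≤ P⁴`) and the conjugation identity
  `norm_midSum_ray_eq`: `|Σ ν(n)ψ̄(n)n^{−(1−s+α−iv)}| = |Σ ν(n)ψ(n)n^{−(s*+iv)}|` (`ν` real for real `χ`),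
  which is how the printed "`ψ(n)n^{−(s*+iv)}`" arises from the integrand's `ψ̄(n)n^{−(1−s−w)}`;
* `alpha_facts_of_four_le_ell`, `bigP_lt_p_le` — `0 < α ≤ 1/8`, `α𝓛 ≤ 1/2090`, `P ≥ 1`; `P < p ≤ 3P`.

No definition, no new named fact. Nothing about Theorems 1–2 or Landau–Siegel zeros.
## References

* Y. Zhang, arXiv:2211.02515v1 (2022), §4 p. 20, proof of (4.8); (4.5) p. 18; (2.6), (2.8), (2.10).
  [cite: Zhang2022LandauSiegel, §4 (4.8) (proof) p. 20]
-/

noncomputable section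

open Complex Real ComplexConjugate MeasureTheory Set

namespace Literature.NumberTheory.LFunctions.Zhang2022.Section4
open Skeleton

/-! ## Parameter bookkeeping -/

section Params

variable {D : ℕ}

/-- `α = π/𝓛⁹` ((2.10) with (2.6)). [cite: Zhang2022LandauSiegel, §2 (2.10)] -/
private theorem alpha_eq_l48 (D : ℕ) : alpha D = π / ell D ^ 9 := by
  rw [alpha, bigP, Real.log_exp]

/-- For `𝓛 ≥ 4`: `0 < α`, `α ≤ 1/8`, `α𝓛 ≤ 1/2090`, `1 ≤ P`. [cite: Zhang2022LandauSiegel, §2 (2.10)] -/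
theorem alpha_facts_of_four_le_ell (hℓ : 4 ≤ ell D) :
    0 < alpha D ∧ alpha D ≤ 1 / 8 ∧ alpha D * ell D ≤ 1 / 2090 ∧ 1 ≤ bigP D := by
  have hℓ0 : 0 < ell D := by linarith
  have h8 : (65536 : ℝ) ≤ ell D ^ 8 := by
    calc (65536 : ℝ) = 4 ^ 8 := by norm_num
      _ ≤ ell D ^ 8 := pow_le_pow_left₀ (by norm_num) hℓ 8
  have h9 : ell D ^ 9 = ell D ^ 8 * ell D := by ring
  have hπ := Real.pi_lt_four
  have hπ0 := Real.pi_pos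
  refine ⟨?_, ?_, ?_, ?_⟩
  · rw [alpha_eq_l48]; positivity
  · rw [alpha_eq_l48, div_le_div_iff₀ (by positivity) (by norm_num)]
    nlinarith
  · rw [alpha_eq_l48, div_mul_eq_mul_div, div_le_div_iff₀ (by positivity) (by norm_num), h9]
    nlinarith
  · exact Real.one_le_exp (by positivity)

/-- Heights on the shifted contour: for `|t − 2πt₀| < 𝓛₁ + 3` and `|v| ≤ 𝓛²⁰` (`𝓛 ≥ 2`),
`𝓛⁵¹⁹ ≤ t + v ≤ 11𝓛⁵¹⁹` (`t₀ = 𝓛⁵¹⁹`, `𝓛₁ = 𝓛⁴⁰⁵`). [cite: Zhang2022LandauSiegel, §2 (2.8)] -/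
private theorem height_range_l48 (hℓ : 2 ≤ ell D) {t v : ℝ} (ht : |t - 2 * π * t0 D| < ell1 D + 3)
    (hv : |v| ≤ ell D ^ 20) : ell D ^ 519 ≤ t + v ∧ t + v ≤ 11 * ell D ^ 519 := by
  rw [t0, ell1] at ht
  obtain ⟨ht1, ht2⟩ := abs_lt.mp ht
  obtain ⟨hv1, hv2⟩ := abs_le.mp hv
  have h1 : (1 : ℝ) ≤ ell D := by linarith
  have h405 : ell D ^ 405 ≤ ell D ^ 519 := pow_le_pow_right₀ h1 (by norm_num)
  have h20 : ell D ^ 20 ≤ ell D ^ 519 := pow_le_pow_right₀ h1 (by norm_num)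
  have h2' : ell D ^ 2 ≤ ell D ^ 519 := pow_le_pow_right₀ h1 (by norm_num)
  have h4 : (4 : ℝ) ≤ ell D ^ 2 := by nlinarith
  have hπ3 : 3 * ell D ^ 519 ≤ π * ell D ^ 519 :=
    mul_le_mul_of_nonneg_right Real.pi_gt_three.le (by positivity)
  have hπ4 : π * ell D ^ 519 ≤ 4 * ell D ^ 519 :=
    mul_le_mul_of_nonneg_right Real.pi_lt_four.le (by positivity)
  constructor <;> linarith

/-- The modulus `p ∼ P`: `P < p ≤ 3P` (window `P < p < P(1 + 𝓛⁻⁶⁸)`, `𝓛 ≥ 1`).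
[cite: Zhang2022LandauSiegel, §2 p. 4] -/
theorem bigP_lt_p_le (hℓ : 1 ≤ ell D) (x : Chr D) :
    bigP D < (x.p : ℝ) ∧ (x.p : ℝ) ≤ 3 * bigP D := by
  have hm := x.mem
  rw [primeWindow, Finset.mem_filter, Finset.mem_Ioo] at hm
  have hP : 0 < bigP D := Real.exp_pos _
  have hP1 : 1 ≤ bigP D := Real.one_le_exp (by positivity)
  have h1 : bigP D < (x.p : ℝ) := (Nat.floor_lt hP.le).mp hm.1.1
  have h2 : (x.p : ℝ) < bigP D * (1 + (ell D ^ 68)⁻¹) := Nat.lt_ceil.mp hm.1.2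
  have h68 : (ell D ^ 68)⁻¹ ≤ 1 := inv_le_one_of_one_le₀ (one_le_pow₀ hℓ)
  refine ⟨h1, ?_⟩
  nlinarith

/-- The base of (4.5) at height `t′ ∈ [𝓛⁵¹⁹, 11𝓛⁵¹⁹]`: `N = p·(Dp)·(t′/2π)²` is positive and
`2𝓛⁹ ≤ log N ≤ 2𝓛⁹ + 1045𝓛` (`P < p ≤ 3P`, `P = e^{𝓛⁹}`, `𝓛 ≥ 4`).
[cite: Zhang2022LandauSiegel, §4 (4.5)] -/
private theorem log_base_l48 (hℓ : 4 ≤ ell D) (x : Chr D) {t' : ℝ} (ht1 : ell D ^ 519 ≤ t')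
    (ht2 : t' ≤ 11 * ell D ^ 519) :
    0 < (x.p : ℝ) * ((D * x.p : ℕ) : ℝ) * (t' / (2 * π)) ^ 2 ∧
      2 * ell D ^ 9 ≤ Real.log ((x.p : ℝ) * ((D * x.p : ℕ) : ℝ) * (t' / (2 * π)) ^ 2) ∧
      Real.log ((x.p : ℝ) * ((D * x.p : ℕ) : ℝ) * (t' / (2 * π)) ^ 2)
        ≤ 2 * ell D ^ 9 + 1045 * ell D := by
  have hℓ1 : 1 ≤ ell D := by linarith
  have hℓ0 : 0 < ell D := by linarith
  obtain ⟨hp1, hp2⟩ := bigP_lt_p_le hℓ1 x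
  have hP : 0 < bigP D := Real.exp_pos _
  have hp0 : (0 : ℝ) < x.p := hP.trans hp1
  have hDℓ : Real.log (D : ℝ) = ell D := rfl
  have hD0 : (0 : ℝ) < D := by
    have h0 : (0 : ℝ) < Real.log (D : ℝ) := by rw [hDℓ]; exact hℓ0
    have hD1 : (1 : ℝ) < D := by
      by_contra h
      push Not at h
      have := Real.log_nonpos (Nat.cast_nonneg D) h
      linarith
    linarith
  -- `t′/2π ∈ [1, 2𝓛⁵¹⁹]`
  have h519 : (8 : ℝ) ≤ ell D ^ 519 := by
    have : (8 : ℝ) ≤ ell D ^ 2 := by nlinarith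
    exact this.trans (pow_le_pow_right₀ hℓ1 (by norm_num))
  have hπ3 := Real.pi_gt_three
  have hπ4 := Real.pi_lt_four
  have hq1 : 1 ≤ t' / (2 * π) := by
    rw [le_div_iff₀ (by positivity)]; nlinarith
  have hq2 : t' / (2 * π) ≤ 2 * ell D ^ 519 := by
    rw [div_le_iff₀ (by positivity)]; nlinarith
  have hq0 : 0 < t' / (2 * π) := by linarith
  -- logarithms of the factors
  have hlogp1 : ell D ^ 9 ≤ Real.log x.p := by
    rw [← Real.log_exp (ell D ^ 9)]
    exact Real.log_le_log hP hp1.le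
  have hlogp2 : Real.log x.p ≤ ell D ^ 9 + 2 := by
    have h3 : Real.log 3 ≤ 2 := by
      have := Real.log_le_sub_one_of_pos (show (0 : ℝ) < 3 by norm_num); linarith
    calc Real.log x.p ≤ Real.log (3 * bigP D) := Real.log_le_log hp0 hp2
      _ = Real.log 3 + ell D ^ 9 := by
          rw [Real.log_mul (by norm_num) hP.ne', bigP, Real.log_exp]
      _ ≤ ell D ^ 9 + 2 := by linarith
  have hlogq1 : 0 ≤ Real.log (t' / (2 * π)) := Real.log_nonneg hq1
  have hlogq2 : Real.log (t' / (2 * π)) ≤ 520 * ell D := by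
    have hlog2 : Real.log 2 ≤ 1 := by have := Real.log_two_lt_d9; linarith
    have hlogℓ : Real.log (ell D) ≤ ell D := by
      have := Real.log_le_sub_one_of_pos hℓ0; linarith
    calc Real.log (t' / (2 * π)) ≤ Real.log (2 * ell D ^ 519) := Real.log_le_log hq0 hq2
      _ = Real.log 2 + 519 * Real.log (ell D) := by
          rw [Real.log_mul (by norm_num) (by positivity), Real.log_pow]; push_cast; ring
      _ ≤ 520 * ell D := by nlinarith
  have hDp : ((D * x.p : ℕ) : ℝ) = (D : ℝ) * x.p := by push_cast; ring
  have hN : Real.log ((x.p : ℝ) * ((D * x.p : ℕ) : ℝ) * (t' / (2 * π)) ^ 2)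
      = Real.log x.p + (ell D + Real.log x.p) + 2 * Real.log (t' / (2 * π)) := by
    rw [hDp, Real.log_mul (by positivity) (by positivity), Real.log_mul hp0.ne' (by positivity),
      Real.log_mul hD0.ne' hp0.ne', Real.log_pow, hDℓ]
    push_cast; ring
  refine ⟨by rw [hDp]; positivity, ?_, ?_⟩
  · rw [hN]; nlinarith
  · rw [hN]; nlinarith

end Params

/-! ## The coefficients: `Σ|ν(n)| ≤ P⁴` and the conjugation identity for real `χ` -/

section Coeff

variable {D : ℕ} [NeZero D] (χ : DirichletCharacter ℂ D)

omit [NeZero D] in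
/-- The trivial size of the middle sum's coefficients: `Σ_{D⁴<n≤P²} |ν(n)| ≤ P⁴`
(`|ν(n)| ≤ τ(n) ≤ n ≤ P²`, at most `P²` terms). [cite: Zhang2022LandauSiegel, §4 (4.8) (proof)] -/
theorem sum_norm_nu_le_bigP_pow_four :
    ∑ n ∈ Finset.Ioc (D ^ 4) ⌊bigP D ^ 2⌋₊, ‖nu χ n‖ ≤ bigP D ^ 4 := by
  have hP2 : 0 ≤ bigP D ^ 2 := by positivity
  have hfl : (⌊bigP D ^ 2⌋₊ : ℝ) ≤ bigP D ^ 2 := Nat.floor_le hP2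
  have hterm : ∀ n ∈ Finset.Ioc (D ^ 4) ⌊bigP D ^ 2⌋₊, ‖nu χ n‖ ≤ bigP D ^ 2 := by
    intro n hn
    have hn2 : n ≤ ⌊bigP D ^ 2⌋₊ := (Finset.mem_Ioc.mp hn).2
    calc ‖nu χ n‖ ≤ (n.divisors.card : ℝ) :=
          Literature.NumberTheory.LFunctions.norm_divisorSumChar_le χ n
      _ ≤ n := by exact_mod_cast Nat.card_divisors_le_self n
      _ ≤ ⌊bigP D ^ 2⌋₊ := by exact_mod_cast hn2
      _ ≤ bigP D ^ 2 := hfl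
  have hcard : ((Finset.Ioc (D ^ 4) ⌊bigP D ^ 2⌋₊).card : ℝ) ≤ bigP D ^ 2 := by
    rw [Nat.card_Ioc]
    calc ((⌊bigP D ^ 2⌋₊ - D ^ 4 : ℕ) : ℝ) ≤ ⌊bigP D ^ 2⌋₊ := by exact_mod_cast Nat.sub_le _ _
      _ ≤ bigP D ^ 2 := hfl
  calc ∑ n ∈ Finset.Ioc (D ^ 4) ⌊bigP D ^ 2⌋₊, ‖nu χ n‖
      ≤ ∑ n ∈ Finset.Ioc (D ^ 4) ⌊bigP D ^ 2⌋₊, bigP D ^ 2 := Finset.sum_le_sum hterm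
    _ = (Finset.Ioc (D ^ 4) ⌊bigP D ^ 2⌋₊).card * bigP D ^ 2 := by
        rw [Finset.sum_const, nsmul_eq_mul]
    _ ≤ bigP D ^ 2 * bigP D ^ 2 := by gcongr
    _ = bigP D ^ 4 := by ring

/-- `conj(n^z) = n^{z̄}` for a natural base. [folklore] -/
private theorem conj_natCast_cpow_l48 (n : ℕ) (z : ℂ) : conj ((n : ℂ) ^ z) = (n : ℂ) ^ conj z := by
  rw [Complex.cpow_conj _ _ (by rw [Complex.natCast_arg]; exact Real.pi_ne_zero.symm)]
  simp

omit [NeZero D] in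
/-- `ν(n)` is real for a real character `χ` (the tree's `Lemma31.divisorSumChar_im_eq_zero`).
[cite: Zhang2022LandauSiegel, §3 p. 6] -/
private theorem conj_nu_l48 (hq : χ.IsQuadratic) (n : ℕ) : conj (nu χ n) = nu χ n :=
  Complex.conj_eq_iff_im.mpr (Lemma31.divisorSumChar_im_eq_zero χ hq.sq_eq_one n)

omit [NeZero D] in
/-- **The conjugation identity behind "`Σ ν(n)ψ(n)n^{−(s*+iv)}`"**: for real `χ`,
`conj(Σ_{D⁴<n≤P²} ν(n)ψ̄(n)n^{−z}) = Σ_{D⁴<n≤P²} ν(n)ψ(n)n^{−z̄}` (so the two sums have the same size;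
with `z = 1 − s + α − iv` one has `z̄ = s* + iv`, `s* = 1 + α − s̄`).
[cite: Zhang2022LandauSiegel, §4 (4.8) (proof) p. 20] -/
theorem conj_midSum (hq : χ.IsQuadratic) (x : Chr D) (z : ℂ) :
    conj (midSum χ x z) = ∑ n ∈ Finset.Ioc (D ^ 4) ⌊bigP D ^ 2⌋₊,
      nu χ n * x.ψ (n : ZMod x.p) * (n : ℂ) ^ (-conj z) := by
  rw [midSum, map_sum]
  refine Finset.sum_congr rfl fun n _ => ?_
  rw [map_mul, map_mul, conj_nu_l48 χ hq n, psiBarFn, Complex.conj_conj, conj_natCast_cpow_l48,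
    map_neg]

omit [NeZero D] in
/-- **`|Σ_{D⁴<n≤P²} ν(n)ψ̄(n)n^{−(1−s−w)}| = |Σ_{D⁴<n≤P²} ν(n)ψ(n)n^{−(s*+iv)}|` at `w = −α + iv`**
(real `χ`; `s* = 1 + α − s̄`). [cite: Zhang2022LandauSiegel, §4 (4.8) (proof) p. 20] -/
theorem norm_midSum_ray_eq (hq : χ.IsQuadratic) (x : Chr D) (s : ℂ) (v : ℝ) :
    ‖midSum χ x (1 - s - (((-alpha D : ℝ) : ℂ) + v * I))‖
      = ‖∑ n ∈ Finset.Ioc (D ^ 4) ⌊bigP D ^ 2⌋₊,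
          nu χ n * x.ψ (n : ZMod x.p) * (n : ℂ) ^ (-(sStar D s + v * I))‖ := by
  rw [← Complex.norm_conj, conj_midSum χ hq]
  have hz : conj (1 - s - (((-alpha D : ℝ) : ℂ) + v * I)) = sStar D s + v * I := by
    simp only [map_sub, map_one, map_add, map_mul, Complex.conj_ofReal, Complex.conj_I, sStar]
    push_cast
    ring
  rw [hz]

end Coeff

/-! ## `Z̃(s+w,ψ)` on the shifted contour -/

section TildeZ

variable {D : ℕ} [NeZero D] (χ : DirichletCharacter ℂ D)

/-- (4.5) as a height-uniform upper bound for the skeleton's `Z̃`: for `D ≥ 3`, `χ` primitive,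
`|Re z| ≤ 11`, `Im z ≥ 82080`: `|Z̃(z,ψ)| ≤ 2(p·Dp·(Im z/2π)²)^{1/2−Re z}` (`ψχ` primitive mod `Dp`,
`SkeletonAssembly.psiChiPrimitive_holds`). [cite: Zhang2022LandauSiegel, §4 (4.5)] -/
theorem norm_tildeZW_le_two_mul_rpow (hD3 : 3 ≤ D) (hχ : χ.IsPrimitive) (x : Chr D) {z : ℂ}
    (hσ : |z.re| ≤ 11) (ht : 82080 ≤ z.im) :
    ‖tildeZW χ x z‖
      ≤ 2 * ((x.p : ℝ) * ((D * x.p : ℕ) : ℝ) * (z.im / (2 * π)) ^ 2) ^ (1 / 2 - z.re) := by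
  have hθ : (psiChi χ x).IsPrimitive := psiChiPrimitive_holds D χ x hD3 hχ
  have h := norm_tildeZ_le_two_mul (ψ := x.ψ) (θ₂ := psiChi χ x) x.prim hθ hσ ht
  rw [Complex.re_add_im] at h
  exact h

/-- **`Z̃` on the ray `w = −α + iv` against `P^{1−2σ}`**: for `𝓛 ≥ 4`, `D ≥ 3`, `χ` primitive,
`½ − 3α < σ < 1 + α`, `|t − 2πt₀| < 𝓛₁ + 3` and `|v| ≤ 𝓛²⁰`:
`|Z̃(s − α + iv, ψ)| ≤ 2e^{2π+2}·P^{1−2σ}` ((4.5) height-uniform, `log(Dp²(t′/2π)²) = 2𝓛⁹ + O(𝓛)`,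
`P^{2α} = e^{2π}`, `(N/P²)^{4α} ≤ e²`). [cite: Zhang2022LandauSiegel, §4 (4.8) (proof) p. 20] -/
theorem norm_tildeZW_ray_le (hℓ : 4 ≤ ell D) (hD3 : 3 ≤ D) (hχ : χ.IsPrimitive) (x : Chr D)
    {s : ℂ} (hσ1 : 1 / 2 - 3 * alpha D < s.re) (hσ2 : s.re < 1 + alpha D)
    (ht : |s.im - 2 * π * t0 D| < ell1 D + 3) {v : ℝ} (hv : |v| ≤ ell D ^ 20) :
    ‖tildeZW χ x (s + (((-alpha D : ℝ) : ℂ) + v * I))‖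
      ≤ 2 * Real.exp (2 * π + 2) * bigP D ^ (1 - 2 * s.re) := by
  obtain ⟨hα0, hα8, hαℓ, hP1⟩ := alpha_facts_of_four_le_ell hℓ
  have hℓ0 : 0 < ell D := by linarith
  set w : ℂ := ((-alpha D : ℝ) : ℂ) + v * I with hw
  have hre : (s + w).re = s.re - alpha D := by simp [hw]; ring
  have him : (s + w).im = s.im + v := by simp [hw]
  obtain ⟨ht1, ht2⟩ := height_range_l48 (by linarith) ht hv
  have h82080 : (82080 : ℝ) ≤ ell D ^ 519 := by
    have h9 : (82080 : ℝ) ≤ ell D ^ 9 := by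
      calc (82080 : ℝ) ≤ 4 ^ 9 := by norm_num
        _ ≤ ell D ^ 9 := pow_le_pow_left₀ (by norm_num) hℓ 9
    exact h9.trans (pow_le_pow_right₀ (by linarith) (by norm_num))
  have hZ := norm_tildeZW_le_two_mul_rpow χ hD3 hχ x (z := s + w)
    (by rw [hre, abs_le]; constructor <;> linarith) (by rw [him]; linarith)
  rw [hre, him] at hZ
  obtain ⟨hN0, hlo, hhi⟩ := log_base_l48 hℓ x ht1 ht2
  set N : ℝ := (x.p : ℝ) * ((D * x.p : ℕ) : ℝ) * ((s.im + v) / (2 * π)) ^ 2 with hN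
  -- the exponent bookkeeping
  set d : ℝ := Real.log N - 2 * ell D ^ 9 with hd
  have hd0 : 0 ≤ d := by rw [hd]; linarith
  have hd1 : d ≤ 1045 * ell D := by rw [hd]; linarith
  have hαd : alpha D * d ≤ 1 / 2 := by
    calc alpha D * d ≤ alpha D * (1045 * ell D) := mul_le_mul_of_nonneg_left hd1 hα0.le
      _ = 1045 * (alpha D * ell D) := by ring
      _ ≤ 1045 * (1 / 2090) := by gcongr
      _ = 1 / 2 := by norm_num
  have hαℓ9 : alpha D * ell D ^ 9 = π := by
    rw [alpha_eq_l48]; field_simp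
  have hkey : Real.log N * (1 / 2 - (s.re - alpha D)) ≤ ell D ^ 9 * (1 - 2 * s.re) + (2 * π + 2) := by
    have e1 : Real.log N = 2 * ell D ^ 9 + d := by rw [hd]; ring
    rw [e1]
    have h3 : (1 / 2 - s.re) * d ≤ 3 * alpha D * d := by
      have : 0 ≤ (3 * alpha D - (1 / 2 - s.re)) * d := mul_nonneg (by linarith) hd0
      nlinarith
    nlinarith
  calc ‖tildeZW χ x (s + w)‖ ≤ 2 * N ^ (1 / 2 - (s.re - alpha D)) := hZ
    _ = 2 * Real.exp (Real.log N * (1 / 2 - (s.re - alpha D))) := by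
        rw [Real.rpow_def_of_pos hN0]
    _ ≤ 2 * Real.exp (ell D ^ 9 * (1 - 2 * s.re) + (2 * π + 2)) := by
        gcongr
    _ = 2 * Real.exp (2 * π + 2) * bigP D ^ (1 - 2 * s.re) := by
        rw [Real.exp_add, show bigP D = Real.exp (ell D ^ 9) from rfl, ← Real.exp_mul]; ring

/-- **`Z̃` on the horizontal segments**: for `𝓛 ≥ 4`, `D ≥ 3`, `χ` primitive, `s ∈ Ω₃′`,
`−σ−½ ≤ u ≤ −α`, `|V′| ≤ 𝓛²⁰`: `|Z̃(s + u + iV′, ψ)| ≤ 2e^{2𝓛⁹+1045𝓛}` (exponent `½ − σ − u ≤ 1`).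
[cite: Zhang2022LandauSiegel, §4 (4.8) (proof) p. 20] -/
theorem norm_tildeZW_horiz_le (hℓ : 4 ≤ ell D) (hD3 : 3 ≤ D) (hχ : χ.IsPrimitive) (x : Chr D)
    {s : ℂ} (hσ2 : s.re < 1 + alpha D)
    (ht : |s.im - 2 * π * t0 D| < ell1 D + 3) {u V' : ℝ} (hu1 : -s.re - 1 / 2 ≤ u)
    (hu2 : u ≤ -alpha D) (hV' : |V'| ≤ ell D ^ 20) :
    ‖tildeZW χ x (s + ((u : ℂ) + V' * I))‖ ≤ 2 * Real.exp (2 * ell D ^ 9 + 1045 * ell D) := by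
  obtain ⟨hα0, hα8, -, -⟩ := alpha_facts_of_four_le_ell hℓ
  set w : ℂ := (u : ℂ) + V' * I with hw
  have hre : (s + w).re = s.re + u := by simp [hw]
  have him : (s + w).im = s.im + V' := by simp [hw]
  obtain ⟨ht1, ht2⟩ := height_range_l48 (by linarith) ht hV'
  have h82080 : (82080 : ℝ) ≤ ell D ^ 519 := by
    have h9 : (82080 : ℝ) ≤ ell D ^ 9 := by
      calc (82080 : ℝ) ≤ 4 ^ 9 := by norm_num
        _ ≤ ell D ^ 9 := pow_le_pow_left₀ (by norm_num) hℓ 9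
    exact h9.trans (pow_le_pow_right₀ (by linarith) (by norm_num))
  have hZ := norm_tildeZW_le_two_mul_rpow χ hD3 hχ x (z := s + w)
    (by rw [hre, abs_le]; constructor <;> linarith) (by rw [him]; linarith)
  rw [hre, him] at hZ
  obtain ⟨hN0, hlo, hhi⟩ := log_base_l48 hℓ x ht1 ht2
  set N : ℝ := (x.p : ℝ) * ((D * x.p : ℕ) : ℝ) * ((s.im + V') / (2 * π)) ^ 2 with hN
  have hlog0 : 0 ≤ Real.log N := by linarith [pow_pos (by linarith : (0:ℝ) < ell D) 9]
  have hkey : Real.log N * (1 / 2 - (s.re + u)) ≤ 2 * ell D ^ 9 + 1045 * ell D := by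
    calc Real.log N * (1 / 2 - (s.re + u)) ≤ Real.log N * 1 :=
          mul_le_mul_of_nonneg_left (by linarith) hlog0
      _ ≤ 2 * ell D ^ 9 + 1045 * ell D := by rw [mul_one]; exact hhi
  calc ‖tildeZW χ x (s + w)‖ ≤ 2 * N ^ (1 / 2 - (s.re + u)) := hZ
    _ = 2 * Real.exp (Real.log N * (1 / 2 - (s.re + u))) := by rw [Real.rpow_def_of_pos hN0]
    _ ≤ 2 * Real.exp (2 * ell D ^ 9 + 1045 * ell D) := by gcongr

/-- **`Z̃` on the tails** (`Re(s+w) = −½`, no Stirling): for `𝓛 ≥ 2`, `D ≥ 3`, `χ` primitive,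
`|t − 2πt₀| < 𝓛₁ + 3`, `|v| ≥ 𝓛²⁰`: `|Z̃(s − σ − ½ + iv, ψ)| ≤ 196·Dp²·𝓛¹⁰³⁸·v²`
(`Section4.norm_tildeZW_le_of_re`, `|τ(θ)| = √k`, `1 + |s+w| ≤ 14𝓛⁵¹⁹|v|`).
[cite: Zhang2022LandauSiegel, §4 (4.8) (proof) p. 20] -/
theorem norm_tildeZW_tail_le (hℓ : 2 ≤ ell D) (hD3 : 3 ≤ D) (hχ : χ.IsPrimitive) (x : Chr D)
    {s : ℂ} (ht : |s.im - 2 * π * t0 D| < ell1 D + 3) {v : ℝ} (hv : ell D ^ 20 ≤ |v|) :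
    ‖tildeZW χ x (s + (((-s.re - 1 / 2 : ℝ) : ℂ) + v * I))‖
      ≤ 196 * ((D : ℝ) * (x.p : ℝ) ^ 2) * ell D ^ 1038 * v ^ 2 := by
  set w : ℂ := ((-s.re - 1 / 2 : ℝ) : ℂ) + v * I with hw
  have hz : (s + w).re = -1 / 2 := by simp [hw]; ring
  have him : (s + w).im = s.im + v := by simp [hw]
  have hθ : (psiChi χ x).IsPrimitive := psiChiPrimitive_holds D χ x hD3 hχ
  have h1 := norm_tildeZW_le_of_re χ x hz
  have hp0 : (0 : ℝ) < x.p := by exact_mod_cast x.prime.pos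
  have hDp0 : (0 : ℝ) < ((D * x.p : ℕ) : ℝ) := by
    have : 0 < D * x.p := Nat.pos_of_ne_zero (NeZero.ne _)
    exact_mod_cast this
  have hτ1 : ‖GammaFactor.tau x.ψ‖ * (x.p : ℝ) ^ (1 / 2 : ℝ) = x.p := by
    rw [GammaFactor.norm_tau x.prim, Real.sqrt_eq_rpow, ← Real.rpow_add hp0]; norm_num
  have hτ2 : ‖GammaFactor.tau (psiChi χ x)‖ * ((D * x.p : ℕ) : ℝ) ^ (1 / 2 : ℝ)
      = ((D * x.p : ℕ) : ℝ) := by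
    rw [GammaFactor.norm_tau hθ, Real.sqrt_eq_rpow, ← Real.rpow_add hDp0]; norm_num
  rw [hτ1, hτ2] at h1
  -- `1 + |s + w| ≤ 14𝓛⁵¹⁹|v|`
  have h1ℓ : (1 : ℝ) ≤ ell D := by linarith
  have h20 : (1 : ℝ) ≤ ell D ^ 20 := one_le_pow₀ h1ℓ
  have hv1 : 1 ≤ |v| := h20.trans hv
  have h519 : (1 : ℝ) ≤ ell D ^ 519 := one_le_pow₀ h1ℓ
  obtain ⟨hta, htb⟩ := height_range_l48 hℓ ht (v := 0) (by rw [abs_zero]; positivity)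
  rw [add_zero] at hta htb
  have hsw : ‖s + w‖ ≤ 1 / 2 + (11 * ell D ^ 519 + |v|) := by
    calc ‖s + w‖ ≤ |(s + w).re| + |(s + w).im| := Complex.norm_le_abs_re_add_abs_im _
      _ = 1 / 2 + |s.im + v| := by rw [hz, him]; norm_num
      _ ≤ 1 / 2 + (|s.im| + |v|) := by gcongr; exact abs_add_le _ _
      _ ≤ 1 / 2 + (11 * ell D ^ 519 + |v|) := by
          gcongr; rw [abs_of_pos (by linarith)]; exact htb
  have hone : 1 + ‖s + w‖ ≤ 14 * ell D ^ 519 * |v| := by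
    have e1 : (3 / 2 : ℝ) ≤ 3 / 2 * (ell D ^ 519 * |v|) := by nlinarith
    have e2 : 11 * ell D ^ 519 ≤ 11 * ell D ^ 519 * |v| := by nlinarith
    have e3 : |v| ≤ ell D ^ 519 * |v| := by nlinarith
    nlinarith
  have hsq : (1 + ‖s + w‖) ^ 2 ≤ (14 * ell D ^ 519 * |v|) ^ 2 :=
    pow_le_pow_left₀ (by positivity) hone 2
  have hDp : ((D * x.p : ℕ) : ℝ) = (D : ℝ) * x.p := by push_cast; ring
  calc ‖tildeZW χ x (s + w)‖ ≤ (x.p : ℝ) * ((D * x.p : ℕ) : ℝ) * (1 + ‖s + w‖) ^ 2 := h1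
    _ ≤ (x.p : ℝ) * ((D * x.p : ℕ) : ℝ) * (14 * ell D ^ 519 * |v|) ^ 2 := by gcongr
    _ = 196 * ((D : ℝ) * (x.p : ℝ) ^ 2) * ell D ^ 1038 * v ^ 2 := by
        rw [hDp, mul_pow, mul_pow, sq_abs]; ring

end TildeZ

end Literature.NumberTheory.LFunctions.Zhang2022.Section4
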